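import Summits.Ventures.LatticeQCDFlow.Scaling.DeathChainComparison
import Summits.Ventures.LatticeQCDFlow.Scaling.IdealStarFreshness

/-!
HONEST FRAMING: exact (Metropolis-corrected) sampling algorithms for lattice gauge theory; figures
of merit are autocorrelation/cost numbers at stated couplings and volumes; no continuum-physics
claim.

# IdealStarStaleCollector — THE STALE COLD LEVELS OF THE IDEALISED STAR SURVIVE THE COUPON-COLLECTOR TIME: ON THE STALE-SET CHAIN `Q` OF `Scaling/DirtySetDecay` (A SWAP `r`
# MOVES `D ↦ (0 κ_r+1)(D)` W.P. `t/m`, A REFRESH `D ↦ D∖{0}` W.P. `1−t`) THE NUMBER `G(D) = |D∖{0}|` OF STALE COLD LEVELS DROPS BY AT MOST ONE PER STEP, WITH PROBABILITY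
# `≤ (t/K)·G` AT UNIFORM LISTING, SO FROM EVERYTHING STALE `(δ_{univ}Qⁿ){G ≥ m} ≥ 1 − s/(s−m)²`, `s = K(1−t/K)ⁿ` (lean-2 GEN-45, ours)

Venture-side (OURS).  Cell `lqcd-flow` (pub-lqcd), unit `pub-lqcd-lean-2-g45`, 2026-08-31.  Chapter AE, file 5 — file 1's comparison on the autonomous stale-set chain of chapter L
(files 12–14: the idealised hot-only hub, one law `ν` at every level, identity maps, exact hot sampler; the augmented chain (configuration, stale set) lumps onto the scheme and onto
`Q`).  A stale cold level `l ∈ D`, `l ≠ 0`, leaves `D∖{0}` only when the swap `(0 l)` is drawn while the hub is clean (`0 ∉ D`): then the stale particle moves to the hub (and is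
refreshed later); at uniform listing (`c` entries per cold level, `m = cK`) this has probability `(t/m)·c·𝟙{0 ∉ D}` per stale cold level, i.e. the down-probability is `≤ (t/K)·G(D)`.

* `stale_coldCount_swap` (`G((0 l)(D)) + 𝟙{l ∈ D} = G(D) + 𝟙{0 ∈ D}`), `stale_sum_indicator`, `stale_coldCount_erase` (`G(D∖{0}) = G(D)`), `stale_coldCount_drop` (`Q(D,D') ≠ 0 ⇒ G(D) ≤ G(D') + 1`),
  `stale_coldCount_down` (`Σ_{D' : G(D')+1 = G(D)} Q(D,D') ≤ (t/K)·G(D)`), **`idealStar_stale_mass_ge`** (`(δ_{univ}Qⁿ){D : m ≤ G(D)} ≥ 1 − s/(s−m)²`, `s = K(1−t/K)ⁿ`, `m < s`, `K ≥ 2`).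

Reading (no numerics implied): this is the input the law-free floor of file 6 needs — by chapter L file 14's freshness, conditionally on the stale set the clean levels are exactly
`ν`-distributed, so the composition seen from the all-`u` start is `|D_n|` copies of `u` plus a `ν`-sample of size `K+1−|D_n|`, and `|D_n| ≥ G(D_n)` stays above `√K` up to the time
`(K/(2t))·log K`.  Literature grade (cell rule): OWN, elementary on file 1 and chapter L's set chain; nothing cited as a fact; no new bib keys.
-/

noncomputable section

open Finset Function
open Literature.Probability.MarkovChains

namespace Summit.Ventures.LatticeQCDFlow.Scaling

section StaleCollector
variable {K m : ℕ} (κ : Fin m → Fin K) {t : ℝ} {Q : Finset (Fin (K + 1)) → Finset (Fin (K + 1)) → ℝ}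

omit κ in
/-- **A swap of the hot level with a cold level `l`:** `G((0 l)(D)) + 𝟙{l ∈ D} = G(D) + 𝟙{0 ∈ D}` — the stale cold count loses one exactly when `l` is stale and the hub is clean,
gains one exactly when the hub is stale and `l` is clean. [ours] -/
theorem stale_coldCount_swap (D : Finset (Fin (K + 1))) (l : Fin (K + 1)) :
    ((D.image (Equiv.swap (0 : Fin (K + 1)) l)).erase 0).card + (if l ∈ D then 1 else 0) = (D.erase 0).card + (if (0 : Fin (K + 1)) ∈ D then 1 else 0) := by
  classical
  set σ := Equiv.swap (0 : Fin (K + 1)) l with hσ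
  -- `|σ(D)| = |D|`, `0 ∈ σ(D) ↔ l ∈ D`
  have hcard : (D.image σ).card = D.card := Finset.card_image_of_injective _ σ.injective
  have hmem : (0 : Fin (K + 1)) ∈ D.image σ ↔ l ∈ D := by
    constructor
    · intro h
      obtain ⟨k, hk, hk0⟩ := mem_image.mp h
      have : k = l := by
        have := congrArg σ.symm hk0
        rw [Equiv.symm_apply_apply] at this
        rw [this, hσ, Equiv.symm_swap, Equiv.swap_apply_left]
      rw [← this]; exact hk
    · intro h; exact mem_image.mpr ⟨l, h, by rw [hσ, Equiv.swap_apply_right]⟩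
  have h1 := Finset.card_erase_add_one (s := D.image σ) (a := 0)
  have h2 := Finset.card_erase_add_one (s := D) (a := 0)
  by_cases h0 : (0 : Fin (K + 1)) ∈ D <;> by_cases hlD : l ∈ D
  · rw [if_pos h0, if_pos hlD, h2 h0]
    have := h1 (hmem.mpr hlD); omega
  · rw [if_pos h0, if_neg hlD, h2 h0, add_zero, Finset.erase_eq_of_notMem (fun h => hlD (hmem.mp h)), hcard]
  · rw [if_neg h0, if_pos hlD, Finset.erase_eq_of_notMem h0, add_zero]
    have := h1 (hmem.mpr hlD); omega
  · rw [if_neg h0, if_neg hlD, Finset.erase_eq_of_notMem h0, Finset.erase_eq_of_notMem (fun h => hlD (hmem.mp h)), hcard]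

omit κ in
/-- A refresh keeps the stale cold count: `G(D∖{0}) = G(D)`. [ours] -/
theorem stale_coldCount_erase (D : Finset (Fin (K + 1))) : ((D.erase 0).erase 0).card = (D.erase 0).card := by
  rw [Finset.erase_eq_of_notMem (Finset.notMem_erase 0 D)]

/-- **`G` drops by at most one per step of `Q`.** [ours] -/
theorem stale_coldCount_drop
    (hQ : ∀ D D', Q D D' = ∑ r : Fin m, t / m * (if D' = D.image (Equiv.swap (0 : Fin (K + 1)) (κ r).succ) then (1 : ℝ)
      else 0) + (1 - t) * (if D' = D.erase 0 then (1 : ℝ) else 0)) (D D' : Finset (Fin (K + 1))) (hDD' : Q D D' ≠ 0) :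
    (D.erase 0).card ≤ (D'.erase 0).card + 1 := by
  classical
  by_contra hlt
  apply hDD'
  rw [hQ]
  have hsw : ∀ r : Fin m, (if D' = D.image (Equiv.swap (0 : Fin (K + 1)) (κ r).succ) then (1 : ℝ) else 0) = 0 := by
    intro r
    rw [if_neg]
    intro h
    have := stale_coldCount_swap D (κ r).succ
    rw [← h] at this
    split_ifs at this <;> omega
  have her : (if D' = D.erase 0 then (1 : ℝ) else 0) = 0 := by
    rw [if_neg]; intro h; rw [h, stale_coldCount_erase] at hlt; omega
  simp_rw [hsw, her, mul_zero, sum_const_zero, add_zero]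

/-- Sums of `Q(D,·)` against an indicator: `Σ_{D'} 𝟙{P(D')}·Q(D,D') = Σ_r (t/m)·𝟙{P((0 κ_r+1)(D))} + (1−t)·𝟙{P(D∖{0})}`. [ours] -/
theorem stale_sum_indicator
    (hQ : ∀ D D', Q D D' = ∑ r : Fin m, t / m * (if D' = D.image (Equiv.swap (0 : Fin (K + 1)) (κ r).succ) then (1 : ℝ)
      else 0) + (1 - t) * (if D' = D.erase 0 then (1 : ℝ) else 0)) (D : Finset (Fin (K + 1))) (P : Finset (Fin (K + 1)) → Prop) [DecidablePred P] :
    ∑ D', (if P D' then (1 : ℝ) else 0) * Q D D'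
      = ∑ r : Fin m, t / m * (if P (D.image (Equiv.swap (0 : Fin (K + 1)) (κ r).succ)) then (1 : ℝ) else 0) + (1 - t) * (if P (D.erase 0) then (1 : ℝ) else 0) := by
  classical
  have hpt : ∀ (D' X : Finset (Fin (K + 1))), (if P D' then (1 : ℝ) else 0) * (if D' = X then (1 : ℝ) else 0) = (if D' = X then (if P X then (1 : ℝ) else 0) else 0) := by
    intro D' X; by_cases h : D' = X
    · rw [if_pos h, h]; simp
    · rw [if_neg h, if_neg h, mul_zero]
  simp_rw [hQ, mul_add, mul_sum, sum_add_distrib]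
  congr 1
  · rw [sum_comm]
    refine sum_congr rfl fun r _ => ?_
    simp_rw [mul_left_comm _ (t / m), ← mul_sum, hpt, Finset.sum_ite_eq' univ, if_pos (mem_univ _)]
  · simp_rw [mul_left_comm _ (1 - t), ← mul_sum, hpt, Finset.sum_ite_eq' univ, if_pos (mem_univ _)]

/-- **THE DOWN-PROBABILITY:** at uniform listing (`c` entries per cold level), `Σ_{D' : G(D')+1 = G(D)} Q(D,D') ≤ (tc/m)·G(D)` (`t ≥ 0`). [ours] -/
theorem stale_coldCount_down (ht0 : 0 ≤ t)
    (hQ : ∀ D D', Q D D' = ∑ r : Fin m, t / m * (if D' = D.image (Equiv.swap (0 : Fin (K + 1)) (κ r).succ) then (1 : ℝ)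
      else 0) + (1 - t) * (if D' = D.erase 0 then (1 : ℝ) else 0))
    {c : ℕ} (hunif : ∀ i : Fin K, (univ.filter fun r : Fin m => κ r = i).card = c) (D : Finset (Fin (K + 1))) :
    ∑ D' ∈ univ.filter (fun D' : Finset (Fin (K + 1)) => (D'.erase 0).card + 1 = (D.erase 0).card), Q D D' ≤ t * c / m * ((D.erase 0).card : ℝ) := by
  classical
  rw [Finset.sum_filter]
  have hmnn : (0 : ℝ) ≤ t / m := div_nonneg ht0 (Nat.cast_nonneg _)
  rw [show (∑ D', if (D'.erase 0).card + 1 = (D.erase 0).card then Q D D' else 0) = ∑ D', (if (D'.erase 0).card + 1 = (D.erase 0).card then (1 : ℝ) else 0) * Q D D' from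
    sum_congr rfl fun D' _ => by split_ifs <;> simp]
  rw [stale_sum_indicator κ hQ D (fun D' => (D'.erase 0).card + 1 = (D.erase 0).card), stale_coldCount_erase]
  have her : (if (D.erase 0).card + 1 = (D.erase 0).card then (1 : ℝ) else 0) = 0 := by rw [if_neg]; omega
  rw [her, mul_zero, add_zero]
  -- the swap part: `𝟙{G drops at r} ≤ 𝟙{κ_r+1 ∈ D∖{0}}`
  have hsw : ∀ r : Fin m, (if ((D.image (Equiv.swap (0 : Fin (K + 1)) (κ r).succ)).erase 0).card + 1 = (D.erase 0).card then (1 : ℝ) else 0)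
      ≤ (if (κ r).succ ∈ D.erase 0 then (1 : ℝ) else 0) := by
    intro r
    have h := stale_coldCount_swap D (κ r).succ
    by_cases hd : ((D.image (Equiv.swap (0 : Fin (K + 1)) (κ r).succ)).erase 0).card + 1 = (D.erase 0).card
    · rw [if_pos hd, if_pos]
      rw [Finset.mem_erase]
      refine ⟨Fin.succ_ne_zero _, ?_⟩
      by_contra hn; rw [if_neg hn] at h; split_ifs at h <;> omega
    · rw [if_neg hd]; split_ifs <;> norm_num
  -- `Σ_r 𝟙{κ_r+1 ∈ D∖{0}} = c·|D∖{0}|`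
  have hcount : ∑ r : Fin m, (if (κ r).succ ∈ D.erase 0 then (1 : ℝ) else 0) = c * ((D.erase 0).card : ℝ) := by
    have e2 : ∀ r : Fin m, (if (κ r).succ ∈ D.erase 0 then (1 : ℝ) else 0) = ∑ l ∈ D.erase 0, (if (κ r).succ = l then (1 : ℝ) else 0) := by
      intro r; rw [Finset.sum_ite_eq]
    simp_rw [e2]
    rw [sum_comm]
    have e3 : ∀ l ∈ D.erase 0, ∑ r : Fin m, (if (κ r).succ = l then (1 : ℝ) else 0) = c := by
      intro l hl
      obtain ⟨hl0, -⟩ := Finset.mem_erase.mp hl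
      obtain ⟨p, rfl⟩ := Fin.exists_succ_eq.mpr hl0
      rw [show (∑ r : Fin m, (if (κ r).succ = p.succ then (1 : ℝ) else 0)) = ∑ r : Fin m, (if κ r = p then (1 : ℝ) else 0) from
        sum_congr rfl fun r _ => by simp only [Fin.succ_inj]]
      rw [← Finset.sum_filter, sum_const, nsmul_eq_mul, mul_one, hunif p]
    rw [sum_congr rfl e3, sum_const, nsmul_eq_mul, mul_comm]
  calc ∑ r : Fin m, t / m * (if ((D.image (Equiv.swap (0 : Fin (K + 1)) (κ r).succ)).erase 0).card + 1 = (D.erase 0).card then (1 : ℝ) else 0)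
      ≤ ∑ r : Fin m, t / m * (if (κ r).succ ∈ D.erase 0 then (1 : ℝ) else 0) := sum_le_sum fun r _ => mul_le_mul_of_nonneg_left (hsw r) hmnn
    _ = t * c / m * ((D.erase 0).card : ℝ) := by rw [← mul_sum, hcount]; ring

/-- **THE STALE COLD LEVELS SURVIVE THE COUPON-COLLECTOR TIME:** at uniform listing (`m = cK`, `c ≥ 1`), `0 ≤ t ≤ 1`, `K ≥ 2`, from everything stale, for every `n` and every
`m₀ < s = K(1−t/K)ⁿ`: **`(δ_{univ}Qⁿ){D : m₀ ≤ |D∖{0}|} ≥ 1 − s/(s−m₀)²`**. [ours] -/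
theorem idealStar_stale_mass_ge (hm : 1 ≤ m) (ht0 : 0 ≤ t) (ht1 : t ≤ 1) (hK : 2 ≤ K)
    (hQ : ∀ D D', Q D D' = ∑ r : Fin m, t / m * (if D' = D.image (Equiv.swap (0 : Fin (K + 1)) (κ r).succ) then (1 : ℝ)
      else 0) + (1 - t) * (if D' = D.erase 0 then (1 : ℝ) else 0))
    {c : ℕ} (hunif : ∀ i : Fin K, (univ.filter fun r : Fin m => κ r = i).card = c) (hmc : m = c * K) (n : ℕ) {m₀ : ℝ}
    (hms : m₀ < (K : ℝ) * (1 - t / K) ^ n) :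
    1 - (K : ℝ) * (1 - t / K) ^ n / ((K : ℝ) * (1 - t / K) ^ n - m₀) ^ 2
      ≤ ∑ D ∈ univ.filter (fun D : Finset (Fin (K + 1)) => m₀ ≤ (((D.erase 0).card : ℕ) : ℝ)), lawAt Q (Pi.single (univ : Finset (Fin (K + 1))) 1) n D := by
  classical
  obtain ⟨Qd, hQd⟩ : ∃ Qd : (ℕ → ℝ) → ℕ → ℝ, ∀ f j, Qd f j = t / K * j * f (j - 1) + (1 - t / K * j) * f j := ⟨fun f j => _, fun _ _ => rfl⟩
  have hKpos : (0 : ℝ) < K := by exact_mod_cast (by omega : 0 < K)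
  have hK2 : (2 : ℝ) ≤ K := by exact_mod_cast hK
  have hθ0 : 0 ≤ t / K := div_nonneg ht0 hKpos.le
  have hθK : t / K * K ≤ 1 := by rw [div_mul_cancel₀ _ hKpos.ne']; exact ht1
  have hθh : 2 * (t / K) ≤ 1 := by rw [show 2 * (t / K) = 2 * t / K by ring, div_le_one hKpos]; nlinarith
  have hQrs : IsRowStochastic Q := dirty_isRowStochastic κ hm ht0 ht1 hQ
  have hGK : ∀ D : Finset (Fin (K + 1)), (D.erase 0).card ≤ K := by
    intro D
    have h1 : (D.erase 0).card ≤ ((univ : Finset (Fin (K + 1))).erase 0).card := Finset.card_le_card (Finset.erase_subset_erase 0 (subset_univ D))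
    rw [Finset.card_erase_of_mem (mem_univ _), card_univ, Fintype.card_fin] at h1
    omega
  have hdrop := stale_coldCount_drop κ hQ
  have hmpos : (0 : ℝ) < m := Nat.cast_pos.mpr (by omega)
  have hcm : t * c / m = t / K := by
    rw [hmc]; push_cast
    have hc0 : (c : ℝ) ≠ 0 := by
      intro hc; rw [hmc] at hmpos; push_cast at hmpos; rw [hc, zero_mul] at hmpos; exact lt_irrefl _ hmpos
    field_simp
  have hdown : ∀ D : Finset (Fin (K + 1)), ∑ D' ∈ univ.filter (fun D' : Finset (Fin (K + 1)) => (D'.erase 0).card + 1 = (D.erase 0).card), Q D D'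
      ≤ t / K * ((D.erase 0).card : ℝ) := fun D => by rw [← hcm]; exact stale_coldCount_down κ ht0 hQ hunif D
  have hG₀ : ((univ : Finset (Fin (K + 1))).erase 0).card = K := by rw [Finset.card_erase_of_mem (mem_univ _), card_univ, Fintype.card_fin]; simp
  have hms' : m₀ < (((((univ : Finset (Fin (K + 1))).erase 0).card : ℕ) : ℝ)) * (1 - t / K) ^ n := by rw [hG₀]; exact hms
  have h := compare_mass_ge (G := fun D : Finset (Fin (K + 1)) => (D.erase 0).card) hQd hθ0 hθh hθK hQrs hGK hdrop hdown univ n hms'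
  simp only [hG₀] at h
  exact h

end StaleCollector

end Summit.Ventures.LatticeQCDFlow.Scaling

end
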